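import Summits.BirchSwinnertonDyer.BirchSwinnertonDyer.Theorems.GenusKolyvaginAtTwoGenusPrimitiveSupplyAtTwoMonskyLemma14b
import Literature.NumberTheory.EllipticCurves.SelmerTorsionTwistRestriction
import HarnessLib

/-!
# Route `GenusKolyvaginAtTwo`, crux #2 `GenusPrimitiveSupplyAtTwo` (stmt-BirchSwinnertonDyer-22136):
# KRAMER 1981 THEOREM 1 + THEOREM 2 (the parity sentence) OVER ℚ FOR EVERY QUADRATIC FIELD, in the tree's local-index currency:
# `rank E(K) + dim Ш(E/K)[2] ≡ Σ_v δ_v(E, K/ℚ) (mod 2)` — no splitting hypothesis on `K`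

Width seat `bsd-line-gk2-p5` g19 (cell `bsd-f1-sign2`, SUPPLY lineage of crux 22136), file 60 of the series; sequel of file 58 (`…MonskyLemma14b`).
THEOREMS ONLY (no definition, no named fact, no `sorry`); helper `--supports stmt-BirchSwinnertonDyer-22136`; no item is closed; BSD is not proved by
any of this.

Kramer 1981 proves (Thm. 1 with Thm. 2): for `K = F(√d)`, `rank E(K) + dim Ш(E/K)[2] ≡ Σ_v i_v (mod 2)`, `i_v` the local norm indices. Mazur–Rubin
2010 (Thm. 2.7, Lemma 2.9) read `i_v = δ_v = dim H¹_f(K_v,E[2]) / (H¹_f(K_v,E[2]) ∩ H¹_f(K_v,E^F[2]))`. In the tree the RIGHT side is the LEAD g10 /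
gk2-p4 g12 Poonen–Rains–Kramer congruence (`GenusKolyKramer.isSquare_card_selmerGroup_mul_of_frame`: `#Sel₂(E^F)·#Sel₂(E)·∏_{v∈S}[𝓚_v : 𝓐_v ⊓ 𝓚_v]`
is a square) and the passage from `d₂(E) + d₂(E^F)` to the LEFT side is file 58's unconditional Mazur–Rubin Lemma 2.5
(`mordellWeilRank_baseChange_add_mod_two_eq_card_selmerGroup_add`: Cassels–Tate over `K` and over `ℚ` + `rk₂(E/K) = rk₂(E) + rk₂(E^F)`). This file
composes them:

* **`isSquare_two_pow_rank_add_mul_prod_relIndex`** — for EVERY elliptic `W/ℚ`, EVERY quadratic field `K` (discriminant `d_K`), every model `Wd` of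
  `W^{(d_K)}`, every FRAMED identification `φ : Wd[2] ≅ W[2]` (e.g. the canonical one of `exists_intertwining_hsplit_and_transverse_inl_frame`), the
  transported Kummer structure `𝓐 = φ_* 𝓚_{Wd}` and any finite `S` off which `𝓐 = 𝓚_W`:
  `2^{rank W(K) + dim Ш(W/K)[2]} · ∏_{v∈S} [𝓚_{W,v} : 𝓐_v ⊓ 𝓚_{W,v}]` is a perfect square — Kramer's Thms. 1+2 over `ℚ`, with no hypothesis on the
  splitting of `2` or of the bad primes (file 58's `Monsky1996_lemma14b_twoSelmerRank_parity_holds` is the case where all of them split and `S = {∞} ∪ {q ∣ d_K}`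
  is evaluated by files 56/57).

References: [Kramer1981] Thm. 1, Thm. 2, Prop. 7; [MazurRubin2010] Thm. 2.7, Lemma 2.5, Lemma 2.9; [KlagsbrunMazurRubin2013] Thm. 3.9, Lemma 5.2;
[Cassels1962ArithmeticIV] §1.
-/

set_option linter.dupNamespace false -- tree convention: `Summit.BirchSwinnertonDyer.BirchSwinnertonDyer.Theorems` (summit = sub-problem)
set_option autoImplicit false

noncomputable section

open scoped Classical ContRepresentation AddSubgroup

namespace Summit.BirchSwinnertonDyer.BirchSwinnertonDyer.Theorems.GenusKolyArch

open WeierstrassCurve NumberField Function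
open Literature.NumberTheory.EllipticCurves Literature.NumberTheory.GaloisRepresentations
open Literature.NumberTheory.EllipticCurves.DokchitserDokchitser2012 (T xT)
open Literature.NumberTheory.GaloisRepresentations.DiscreteGaloisModule (SelmerStructure)
open Literature.NumberTheory.GaloisCohomology

/-- Square cancellation in `ℕ`: `y · c²` a square, `c ≠ 0` ⟹ `y` a square. [folklore] -/
theorem isSquare_of_isSquare_mul_sq {y c : ℕ} (hc : c ≠ 0) (h : IsSquare (y * c ^ 2)) : IsSquare y := by
  obtain ⟨r, hr⟩ := h
  have hdvd : c ^ 2 ∣ r ^ 2 := ⟨y, by rw [sq r, ← hr]; ring⟩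
  obtain ⟨k, rfl⟩ := (Nat.pow_dvd_pow_iff two_ne_zero).mp hdvd
  refine ⟨k, ?_⟩
  have hc2 : c ^ 2 ≠ 0 := pow_ne_zero 2 hc
  apply Nat.eq_of_mul_eq_mul_right (Nat.pos_of_ne_zero hc2)
  rw [hr]
  ring

/-- Transport of a square along a parity: `2^a · P` a square and `a ≡ b (mod 2)` ⟹ `2^b · P` a square. [folklore] -/
theorem isSquare_two_pow_mul_of_mod_two_eq {a b P : ℕ} (h : IsSquare (2 ^ a * P)) (hab : a % 2 = b % 2) : IsSquare (2 ^ b * P) := by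
  -- `(2^b P) · (2^a)² = (2^a P) · 2^{a+b}` and `a + b` is even
  obtain ⟨j, hj⟩ : ∃ j, a + b = 2 * j := ⟨(a + b) / 2, by omega⟩
  have hsq : IsSquare (2 ^ b * P * (2 ^ a) ^ 2) := by
    obtain ⟨r, hr⟩ := h
    refine ⟨r * 2 ^ j, ?_⟩
    calc 2 ^ b * P * (2 ^ a) ^ 2 = (2 ^ a * P) * 2 ^ (a + b) := by ring
      _ = (r * r) * (2 ^ j) ^ 2 := by rw [hr, hj]; ring
      _ = r * 2 ^ j * (r * 2 ^ j) := by ring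
  exact isSquare_of_isSquare_mul_sq (pow_ne_zero a two_ne_zero) hsq

variable (W : WeierstrassCurve ℚ) [W.IsElliptic] (K : Type) [Field K] [NumberField K]

/-- **KRAMER 1981, THEOREMS 1 + 2 OVER `ℚ` (the parity sentence), EVERY QUADRATIC FIELD**, in the tree's local-index currency: for `W/ℚ` elliptic,
`K` quadratic of discriminant `d_K`, `Wd` any model of `W^{(d_K)}`, a FRAMED injective identification `φ : Wd[2] → W[2]` (`φ T'_j = T_{πj}`, affinely
related abscissae), the transported Kummer structure `𝓐 = φ_* 𝓚_{Wd}` and any finite `S` off which `𝓐 = 𝓚_W`: with `#Ш(W/K)[2] = 2^u`,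
**`2^{rank W(K) + u} · ∏_{v∈S} [𝓚_{W,v} : 𝓐_v ⊓ 𝓚_{W,v}]` is a perfect square**, i.e. `rank W(K) + dim Ш(W/K)[2] ≡ Σ_v δ_v (mod 2)`.
Composition of the framed Poonen–Rains–Kramer congruence (`GenusKolyKramer.isSquare_card_selmerGroup_mul_of_frame`) with the unconditional Mazur–Rubin
Lemma 2.5 of file 58 (`mordellWeilRank_baseChange_add_mod_two_eq_card_selmerGroup_add`). [cite: Kramer1981, Thm. 1, Thm. 2 and Prop. 7]
[cite: MazurRubin2010, Thm. 2.7, Lemma 2.5, Lemma 2.9] [cite: KlagsbrunMazurRubin2013, Thm. 3.9] -/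
theorem isSquare_two_pow_rank_add_mul_prod_relIndex (h2 : Module.finrank ℚ K = 2)
    {Wd : WeierstrassCurve ℚ} [Wd.IsElliptic] {C : VariableChange ℚ} (hWd : C • W.quadraticTwist (NumberField.discr K : ℚ) = Wd)
    (φ : (Wd.torsionGaloisModule ((2 : ℕ) : ℤ)).toContRepresentation →ⁱL (W.torsionGaloisModule ((2 : ℕ) : ℤ)).toContRepresentation)
    (hφ : Function.Injective φ) (π : Fin 3 → Fin 3)
    (hπ : ∀ j, (show (Wd.torsionGaloisModule 2).toContRepresentation →ⁱL (W.torsionGaloisModule 2).toContRepresentation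
      from φ) (T Wd (two_ne_zero (α := ℚ)) j) = T W (two_ne_zero (α := ℚ)) (π j))
    (A : ℚ) (hA : ∀ i j, xT Wd (two_ne_zero (α := ℚ)) i - xT Wd (two_ne_zero (α := ℚ)) j
      = algebraMap ℚ (AlgebraicClosure ℚ) A * (xT W (two_ne_zero (α := ℚ)) (π i) - xT W (two_ne_zero (α := ℚ)) (π j)))
    (𝓐 : SelmerStructure (W.torsionGaloisModule ((2 : ℕ) : ℤ)))
    (h𝓐 : ∀ v, 𝓐 v = (Wd.kummerSelmerStructure ((2 : ℕ) : ℤ) v).map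
      (galoisCohomology.map (φ.restrictField (Place.Completion v)) 1))
    (S : Finset (Place ℚ)) (hS : ∀ v ∉ S, 𝓐 v = W.kummerSelmerStructure ((2 : ℕ) : ℤ) v)
    {u : ℕ} (hu : Nat.card (((W.baseChange K).sha)[(2 : ℤ)]) = 2 ^ u) :
    IsSquare (2 ^ ((W.baseChange K).mordellWeilRank + u) * ∏ v ∈ S, (𝓐 v).relIndex (W.kummerSelmerStructure ((2 : ℕ) : ℤ) v)) := by
  have hd0 : ((NumberField.discr K : ℤ) : ℚ) ≠ 0 := by exact_mod_cast NumberField.discr_ne_zero K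
  haveI := W.isElliptic_quadraticTwist hd0
  obtain ⟨s, hs⟩ := exists_natCard_selmerGroup_two_eq_pow W
  obtain ⟨s', hs'⟩ := exists_natCard_selmerGroup_two_eq_pow Wd
  -- `#Sel₂(Wd) = #Sel₂(W^{(d_K)})` (isomorphic models)
  have hsd : Nat.card ((W.quadraticTwist (NumberField.discr K : ℚ)).selmerGroup ((2 : ℕ) : ℤ)) = 2 ^ s' := by
    rw [natCard_selmerGroup_eq_of_variableChange ((2 : ℕ) : ℤ) hWd, hs']
  -- Mazur–Rubin Lemma 2.5 (file 58) and the framed Kramer congruence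
  have hpar := mordellWeilRank_baseChange_add_mod_two_eq_card_selmerGroup_add K W h2 hu hs hsd
  have hK := GenusKolyKramer.isSquare_card_selmerGroup_mul_of_frame W Wd φ hφ π hπ A hA 𝓐 h𝓐 S hS
  rw [hs, hs', ← pow_add, add_comm s' s] at hK
  exact isSquare_two_pow_mul_of_mod_two_eq hK hpar.symm

end Summit.BirchSwinnertonDyer.BirchSwinnertonDyer.Theorems.GenusKolyArch

end
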